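import Mathlib
import HarnessLib
import HarnessLib.Audit
import Summits.AtomisticToContinuum.Statement
import Literature.MathematicalPhysics.QuantumManyBody.PeriodicBoseGas
import Literature.MathematicalPhysics.QuantumManyBody.GroundState
import Summits.AtomisticToContinuum.BoseEinsteinCondensation.Theorems.BECInfraredBoundAssembly
import HarnessLib.Audit.Status.Attr

/-!
Route: BECWallDressingTransfer

DORMANT since 2026-08-25T09:13:53Z (reconciler: no traction for 7.6 d (last activity item-evidence-added at 2026-08-17T19:09:23Z); parked, not closed — `ledger route dormant route-AtomisticToContinuum-BECWallDressingTransfer --off` to r) — unstaffed, not closed; items shared with open routes are served there. `ledger route dormant <id> --off` reactivates.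

# Route BECWallDressingTransfer — wall dressing — Ψ_Dir/(Ψ_torus·∏ one-body wall profiles) has
N-uniform one-particle oscillation, so the torus landscape transfers to the Dirichlet flat mode

Conforming re-open (D-0027 §2.1) of route BECWallDressing (retired 2026-08-15T13:41Z only because
its Assembly concluded the Literature decl, not the
sub-problem abbrev `_root_.BoseEinsteinCondensation`), re-engineered: it suffices to show X =
WallDressing ∧ TorusLandscapeDirichletTypical ∧ GroundStatePair ∧
GroundStateRigidity (card wall-dressing-transfer: W1 = WallDressing; W2+torus input jointly =
TorusLandscapeDirichletTypical, typed under the DIRICHLET law as the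
novelty audits asked; existence/uniqueness never smuggled = GroundStatePair + the shared
GroundStateRigidity). Objects: N+1 bosons, L = sideLength ρ (N+1),
Ψ₀ = the tree's canonical Dirichlet ground state `BoseGas.groundState v (N+1) L` (guarded by
`HasUniqueGroundState`), Φ₀ = the torus ground state of side L+a
(a ≥ a₀(v) > range v, so no periodic image ever meets the box — inlined interface: continuous,
periodic, ≥ 0, L²-limit up to phase of ALL periodic near-minimisers),
x :: Y = Matrix.vecCons x Y, w_D(dY) = ∫Ψ₀(x::Y)²dx dY the Dirichlet law of the environment.
(W) WallDressing: for w_D-all-but-η environments Y the ratio Ψ₀(x::Y)/(Φ₀(x::Y)·s(x)), s(z) = ∏_k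
min(1, z_k/ℓ, (L−z_k)/ℓ) a product ONE-BODY wall profile
(some ℓ ∈ (0, εL]), oscillates over x ∈ Λ_a = (a, L−a)³ by at most a factor C(ε,η) UNIFORM IN N —
typed a.e.-robustly: the set of violating pairs (x,y) ∈ Λ_a² has volume 0.
(T) TorusLandscapeDirichletTypical: for w_D-all-but-η environments the torus conditional amplitude x
↦ Φ₀(x::Y) is delocalised on every inner cube Λ'_ε, ε ∈ [0,1/4):
(∫_Λ' Φ₀)² > c·|Λ'|·∫_Λ' Φ₀² with c = c(ε,η,a) uniform in N. (G) GroundStatePair: for all large N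
the Dirichlet ground state is unique (HasUniqueGroundState) and the
torus interface is inhabited. (R) GroundStateRigidity (stmt-9072 verbatim): δ-near-minimisers are
mutually L²-close up to phase. Then pure measure theory
(LandscapeTransfer, NearMinimiserTransfer) gives the shared target X_B1 = ZeroModeOccupation
(stmt-0686: flat-mode occupation ≥ cN for all δ-near-minimisers), and
the PROVED tree theorem AtomisticToContinuum.BECInfraredBound.bec_of_zeroMode decides the conjunct.
Lean: `(∀ v : ℝ → ENNReal,
Literature.MathematicalPhysics.QuantumManyBody.BoseGas.IsRepulsiveFiniteRange v → ∃ a₀ : ℝ, 0 < a₀ ∧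
∀ a : ℝ, a₀ ≤ a → ∃ ρ₀ : ℝ, 0 < ρ₀ ∧ ∀ ρ : ℝ, 0 < ρ → ρ < ρ₀ → ∀ ε : ℝ, 0 < ε → ∀ η : ℝ, 0 < η → ∃ C
: ℝ, 0 < C ∧ ∀ᶠ N : ℕ in Filter.atTop, let L : ℝ :=
Literature.MathematicalPhysics.QuantumManyBody.BoseGas.sideLength ρ (N + 1); let Ψ₀ :
Literature.MathematicalPhysics.QuantumManyBody.BoseGas.Config (N + 1) → ℝ :=
Literature.MathematicalPhysics.QuantumManyBody.BoseGas.groundState v (N + 1) L;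
Literature.MathematicalPhysics.QuantumManyBody.BoseGas.HasUniqueGroundState v (N + 1) L → ∃ ℓ : ℝ, 0
< ℓ ∧ ℓ ≤ ε * L ∧ (let Λa : Set Literature.MathematicalPhysics.QuantumManyBody.BoseGas.Space := {z :
Literature.MathematicalPhysics.QuantumManyBody.BoseGas.Space | ∀ k, z k ∈ Set.Ioo a (L - a)}; let s
: Literature.MathematicalPhysics.QuantumManyBody.BoseGas.Space → ℝ := fun z => ∏ k : Fin 3, min 1
(min (z k / ℓ) ((L - z k) / ℓ)); ∀ Φ₀ :
Literature.MathematicalPhysics.QuantumManyBody.BoseGas.Config (N + 1) → ℝ, (Continuous Φ₀ ∧ (∀ (X :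
Literature.MathematicalPhysics.QuantumManyBody.BoseGas.Config (N + 1)) (i : Fin (N + 1)) (k : Fin
3), Φ₀ (X + Pi.single i (EuclideanSpace.single k (L + a))) = Φ₀ X) ∧ (∀ X, 0 ≤ Φ₀ X) ∧ ∀ η' : ℝ, 0 <
η' → ∃ δ : ENNReal, 0 < δ ∧ ∀ Φ :
Literature.MathematicalPhysics.QuantumManyBody.BoseGas.PeriodicTrialState (N + 1) (L + a),
Literature.MathematicalPhysics.QuantumManyBody.BoseGas.periodicEnergy v Φ ≤
Literature.MathematicalPhysics.QuantumManyBody.BoseGas.periodicGroundStateEnergy v (N + 1) (L + a) +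
δ → ∃ θ : ℝ, ∫⁻ X in Literature.MathematicalPhysics.QuantumManyBody.BoseGas.cellN (N + 1) (L + a),
(‖Φ.ψ X - Complex.exp (↑θ * Complex.I) * (Φ₀ X : ℂ)‖₊ : ENNReal) ^ 2 ≤ ENNReal.ofReal η') → ∫⁻ Y :
Literature.MathematicalPhysics.QuantumManyBody.BoseGas.Config N, Set.indicator {Y :
Literature.MathematicalPhysics.QuantumManyBody.BoseGas.Config N | MeasureTheory.volume {p :
Literature.MathematicalPhysics.QuantumManyBody.BoseGas.Space ×
Literature.MathematicalPhysics.QuantumManyBody.BoseGas.Space | p.1 ∈ Λa ∧ p.2 ∈ Λa ∧ C * (Ψ₀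
(Matrix.vecCons p.2 Y) * Φ₀ (Matrix.vecCons p.1 Y) * s p.1) < Ψ₀ (Matrix.vecCons p.1 Y) * Φ₀
(Matrix.vecCons p.2 Y) * s p.2} ≠ 0} (fun _ => (1 : ENNReal)) Y * (∫⁻ x :
Literature.MathematicalPhysics.QuantumManyBody.BoseGas.Space, ENNReal.ofReal (Ψ₀ (Matrix.vecCons x
Y) ^ 2)) ≤ ENNReal.ofReal η)) ∧ (∀ v : ℝ → ENNReal,
Literature.MathematicalPhysics.QuantumManyBody.BoseGas.IsRepulsiveFiniteRange v → ∃ a₀ : ℝ, 0 ≤ a₀ ∧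
∀ a : ℝ, a₀ ≤ a → ∃ ρ₀ : ℝ, 0 < ρ₀ ∧ ∀ ρ : ℝ, 0 < ρ → ρ < ρ₀ → ∀ ε : ℝ, 0 ≤ ε → ε < 1 / 4 → ∀ η : ℝ,
0 < η → ∃ c : ℝ, 0 < c ∧ ∀ᶠ N : ℕ in Filter.atTop, let L : ℝ :=
Literature.MathematicalPhysics.QuantumManyBody.BoseGas.sideLength ρ (N + 1); let Ψ₀ :
Literature.MathematicalPhysics.QuantumManyBody.BoseGas.Config (N + 1) → ℝ :=
Literature.MathematicalPhysics.QuantumManyBody.BoseGas.groundState v (N + 1) L; let Λ' : Set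
Literature.MathematicalPhysics.QuantumManyBody.BoseGas.Space := {z :
Literature.MathematicalPhysics.QuantumManyBody.BoseGas.Space | ∀ j, z j ∈ Set.Ioo (ε * L) (L - ε *
L)}; Literature.MathematicalPhysics.QuantumManyBody.BoseGas.HasUniqueGroundState v (N + 1) L → ∀ Φ₀
: Literature.MathematicalPhysics.QuantumManyBody.BoseGas.Config (N + 1) → ℝ, (Continuous Φ₀ ∧ (∀ (X
: Literature.MathematicalPhysics.QuantumManyBody.BoseGas.Config (N + 1)) (i : Fin (N + 1)) (k : Fin
3), Φ₀ (X + Pi.single i (EuclideanSpace.single k (L + a))) = Φ₀ X) ∧ (∀ X, 0 ≤ Φ₀ X) ∧ ∀ η' : ℝ, 0 <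
η' → ∃ δ : ENNReal, 0 < δ ∧ ∀ Φ :
Literature.MathematicalPhysics.QuantumManyBody.BoseGas.PeriodicTrialState (N + 1) (L + a),
Literature.MathematicalPhysics.QuantumManyBody.BoseGas.periodicEnergy v Φ ≤
Literature.MathematicalPhysics.QuantumManyBody.BoseGas.periodicGroundStateEnergy v (N + 1) (L + a) +
δ → ∃ θ : ℝ, ∫⁻ X in Literature.MathematicalPhysics.QuantumManyBody.BoseGas.cellN (N + 1) (L + a),
(‖Φ.ψ X - Complex.exp (↑θ * Complex.I) * (Φ₀ X : ℂ)‖₊ : ENNReal) ^ 2 ≤ ENNReal.ofReal η') → ∫⁻ Y :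
Literature.MathematicalPhysics.QuantumManyBody.BoseGas.Config N, Set.indicator {Y :
Literature.MathematicalPhysics.QuantumManyBody.BoseGas.Config N | (∫⁻ x in Λ', ENNReal.ofReal (Φ₀
(Matrix.vecCons x Y))) ^ 2 ≤ ENNReal.ofReal c * MeasureTheory.volume Λ' * ∫⁻ x in Λ', ENNReal.ofReal
(Φ₀ (Matrix.vecCons x Y) ^ 2)} (fun _ => (1 : ENNReal)) Y * (∫⁻ x :
Literature.MathematicalPhysics.QuantumManyBody.BoseGas.Space, ENNReal.ofReal (Ψ₀ (Matrix.vecCons x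
Y) ^ 2)) ≤ ENNReal.ofReal η) ∧ (∀ v : ℝ → ENNReal,
Literature.MathematicalPhysics.QuantumManyBody.BoseGas.IsRepulsiveFiniteRange v → ∀ a : ℝ, 0 ≤ a → ∃
ρ₀ : ℝ, 0 < ρ₀ ∧ ∀ ρ : ℝ, 0 < ρ → ρ < ρ₀ → ∀ᶠ N : ℕ in Filter.atTop, let L : ℝ :=
Literature.MathematicalPhysics.QuantumManyBody.BoseGas.sideLength ρ (N + 1);
Literature.MathematicalPhysics.QuantumManyBody.BoseGas.HasUniqueGroundState v (N + 1) L ∧ ∃ Φ₀ :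
Literature.MathematicalPhysics.QuantumManyBody.BoseGas.Config (N + 1) → ℝ, (Continuous Φ₀ ∧ (∀ (X :
Literature.MathematicalPhysics.QuantumManyBody.BoseGas.Config (N + 1)) (i : Fin (N + 1)) (k : Fin
3), Φ₀ (X + Pi.single i (EuclideanSpace.single k (L + a))) = Φ₀ X) ∧ (∀ X, 0 ≤ Φ₀ X) ∧ ∀ η' : ℝ, 0 <
η' → ∃ δ : ENNReal, 0 < δ ∧ ∀ Φ :
Literature.MathematicalPhysics.QuantumManyBody.BoseGas.PeriodicTrialState (N + 1) (L + a),
Literature.MathematicalPhysics.QuantumManyBody.BoseGas.periodicEnergy v Φ ≤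
Literature.MathematicalPhysics.QuantumManyBody.BoseGas.periodicGroundStateEnergy v (N + 1) (L + a) +
δ → ∃ θ : ℝ, ∫⁻ X in Literature.MathematicalPhysics.QuantumManyBody.BoseGas.cellN (N + 1) (L + a),
(‖Φ.ψ X - Complex.exp (↑θ * Complex.I) * (Φ₀ X : ℂ)‖₊ : ENNReal) ^ 2 ≤ ENNReal.ofReal η')) ∧ (∀ v :
ℝ → ENNReal, Literature.MathematicalPhysics.QuantumManyBody.BoseGas.IsRepulsiveFiniteRange v → ∃ ρ₀
: ℝ, 0 < ρ₀ ∧ ∀ ρ : ℝ, 0 < ρ → ρ < ρ₀ → ∀ᶠ N : ℕ in Filter.atTop, ∀ η : ℝ, 0 < η → ∃ δ : ENNReal, 0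
< δ ∧ ∀ Ψ Φ : Literature.MathematicalPhysics.QuantumManyBody.BoseGas.TrialState N
(Literature.MathematicalPhysics.QuantumManyBody.BoseGas.sideLength ρ N),
Literature.MathematicalPhysics.QuantumManyBody.BoseGas.energy v Ψ ≤
Literature.MathematicalPhysics.QuantumManyBody.BoseGas.groundStateEnergy v N
(Literature.MathematicalPhysics.QuantumManyBody.BoseGas.sideLength ρ N) + δ →
Literature.MathematicalPhysics.QuantumManyBody.BoseGas.energy v Φ ≤
Literature.MathematicalPhysics.QuantumManyBody.BoseGas.groundStateEnergy v N
(Literature.MathematicalPhysics.QuantumManyBody.BoseGas.sideLength ρ N) + δ → ∃ c : ℂ, ‖c‖ = 1 ∧ ∫⁻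
X, (‖Ψ.ψ X - c * Φ.ψ X‖₊ : ENNReal) ^ 2 ≤ ENNReal.ofReal η)`

## Assembly
NearMinimiserTransfer ∘ LandscapeTransfer turn the four cruxes (+ WallLayerMass) into the shared
target X_B1 = ZeroModeOccupation, and the PROVED tree
theorem `AtomisticToContinuum.BECInfraredBound.bec_of_zeroMode`
(Theorems/BECInfraredBoundAssembly.lean, imported) takes X_B1 to the conjunct
(occupation_le_maxOccupation for the measurable normalised flat mode + le_condensateNumber).
Deciding theorem (glue.lean, rc 0 in Sketch.lean, axioms
propext/Classical.choice/Quot.sound): `theorem closes (hW : WallDressing) (hT :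
TorusLandscapeDirichletTypical) (hG : GroundStatePair) (hR : GroundStateRigidity)
(hM : WallLayerMass) (hL : LandscapeTransfer) (hN : NearMinimiserTransfer) :
_root_.BoseEinsteinCondensation := AtomisticToContinuum.BECInfraredBound.bec_of_zeroMode (hN (hL hW
hT hM hG) hR hG)` (rev 2: NearMinimiserTransfer takes GroundStateFlatMode — inlined verbatim — then
GroundStateRigidity, GroundStatePair).

Rationale: WHY THIS LINE. The audited conjunct is DIRICHLET while every engine (Fournais2020, FournaisEtAl2024,
Junge2026 arXiv:2603.20776, ChongLiangNam2026 arXiv:2510.20493, and the hub's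
torus-fed routes BECMeanFieldControl, BECLiebAntibunching, BECIroning, BECLaplacianL1,
BECGroundStateSOS, BECInfDivCoherence) works on the TORUS, the latter consuming the
orphan crux BoundaryTransferWeak (stmt-0827), for which nothing is in print for the condensate
FRACTION (energy only: Robinson1976, LSSY2005 Ch. 2 after (2.8), Basti2022). Positivity gives a
mechanism:
Ψ_Dir/Ψ_torus is the principal eigenfunction of the torus ground-state diffusion killed at the faces
(a many-body Doob h-transform), and the thesis is that it is
PRODUCT-LIKE in each tagged variable up to bounded distortion — a boundary-Harnack /
intrinsic-ultracontractivity comparison (BassBurdzy1991, DaviesSimon1984, Pinsky1995,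
Wang2012) whose whole difficulty is uniformity in the dimension 3N, with one-body factor the
Gross–Pitaevskii healing profile (LiebSeiringer2002, LSSY2005 Ch. 6–7,
Margetis2000). Imported areas: potential theory of positive harmonic functions / h-transforms
(probability–PDE) and GP boundary-layer theory; the currency is the
landscape (flat-mode, typical-set) criterion of the positivity cards, in which O(1) multiplicative
losses are free. New w.r.t. the retired gen-1 route: statements
over the landed `groundState`/`HasUniqueGroundState` vocabulary (a.e.-robust), the torus enlarged to
side L+a (with side L, hard-core environments typical for the
Dirichlet law kill every torus slice through periodic images — the old transfer was vacuous there),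
two shared items (9072, 0686) and a `closes` resting on a proved cone fact.

RANKED CRUXES. #0 ZeroModeOccupation (target) — X_B1 verbatim (stmt-AtomisticToContinuum-0686,
shared with BECInfraredBound / BECStoquasticCensoring): for every repulsive finite-range v, at all
small ρ, some c > 0: for all large N there is δ > 0 such that every δ-near-minimiser of the
Dirichlet energy in the box of side (N/ρ)^(1/3) has flat-mode occupation ⟨φ₀, γ_Ψ φ₀⟩ ≥ cN, φ₀ =
L^(−3/2)·1_box. Reached here only through NearMinimiserTransfer; bec_of_zeroMode (proved) takes it
to the conjunct. (why it might fail: it is flat-mode Dirichlet BEC itself (implies the conjunct);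
fails only with the conjunct, or if the flat mode is the wrong mode (it is not: free gas (8/π²)³,
interacting gas heals beyond ξ ≪ L).) [LSSY2005, PenroseOnsager1956, Robinson1976]
#2 WallDressing (crux) — (card W1, a.e.-robust boundary-Harnack form) for every repulsive
finite-range v there is a₀ > 0 (> its range) such that for every a ≥ a₀, at all small ρ, for every ε
> 0 and η > 0 there is C with: for all large N, if the Dirichlet ground state Ψ₀ = groundState v
(N+1) L (L = sideLength ρ (N+1)) is unique, there is ℓ ∈ (0, εL] such that for every torus ground
state Φ₀ of side L+a (inlined interface) the set of environments Y ∈ (ℝ³)^N whose violating pairs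
{(x,y) ∈ Λ_a² : C·Ψ₀(y::Y)Φ₀(x::Y)s(x) < Ψ₀(x::Y)Φ₀(y::Y)s(y)} have positive volume — i.e. the
essential one-particle oscillation of Ψ₀/(Φ₀·s) over Λ_a = (a, L−a)³ exceeds C; s(z) = ∏_k min(1,
z_k/ℓ, (L−z_k)/ℓ) — has w_D-mass ≤ η. Free gas: ℓ = min(ε,1/2)L, C = (π/(2 sin(πℓ/L)))³, bad set
empty. [difficulty: XL] (why it might fail: Ψ_D/Ψ_P is harmonic for the FULL 3(N+1)-dim ground-state
diffusion, not in x alone: Harnack/IU constants grow with dimension (DaviesSimon1984) unless the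
drift ∇log Φ₀² is controlled uniformly (Wang2012); an L²-Poincaré loss or an unscreened phonon tail
gives osc ~ log L.) [DaviesSimon1984, BassBurdzy1991, Pinsky1995, Wang2012, LiebSeiringer2002,
LSSY2005, Margetis2000]
#3 TorusLandscapeDirichletTypical (crux) — (card W2 + the torus input, jointly, typical-set form)
for every repulsive finite-range v there is a₀ ≥ 0 such that for every a ≥ a₀, at all small ρ, for
every ε ∈ [0,1/4) and η > 0 there is c > 0 with: for all large N, if the Dirichlet ground state is
unique, for every torus ground state Φ₀ of N+1 bosons on the torus of side L+a (interface) the set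
of environments Y for which (∫_Λ'ε Φ₀(x::Y)dx)² ≤ c·|Λ'ε|·∫_Λ'ε Φ₀(x::Y)²dx on the inner cube Λ'_ε =
(εL, L−εL)³ of the BOX (non-strict: identically vanishing slices count as bad) has w_D-mass ≤ η —
delocalisation of the torus landscape, measured under the DIRICHLET law of the environment. Free
gas: Φ₀ constant, c = 1/2, bad set empty. [difficulty: XL] (why it might fail: Dirichlet-typical Y
(depleted wall layer, ~N^(2/3) displaced bosons) are torus-atypical at large-deviation scale; torus
engines give π_P-AVERAGES of the landscape ratio only (E R ≥ c, not R ≥ c(η) off mass η); needs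
concentration + stability under wall conditioning. False in d = 1.) [LSSY2005, Fournais2020,
Junge2026, ChongLiangNam2026, arXiv:2603.20776, arXiv:2510.20493,
Literature.Barriers.AtomisticToContinuum.PitaevskiiStringariOneDimension]
#4 GroundStatePair (crux) — for every repulsive finite-range v and every a ≥ 0, at all small ρ and
for all large N (L = sideLength ρ (N+1)): `HasUniqueGroundState v (N+1) L` (a nonnegative Dirichlet
ground state exists and ground states are unique up to phase — so `groundState v (N+1) L` is it),
AND the torus interface of side L+a is inhabited: a continuous, (L+a)-periodic, nonnegative Φ₀ such
that for every η' > 0 some δ > 0 puts every periodic δ-near-minimiser within η' of e^(iθ)Φ₀ in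
L²(cell^(N+1)) (existence + uniqueness up to phase + continuity of the torus ground state: compact
resolvent, positivity-improving semigroup, elliptic regularity; E₀ < ⊤ at ρ < c·range⁻³ by a lattice
product trial state). [difficulty: L] (why it might fail: ⊤-valued v (hard cores/shells) are
admissible: the accessible region may disconnect and the cube's symmetries then force exact
degeneracy unless the dilute component is the unique energy minimiser (unproved); continuity of the
torus ground state for wild measurable v is unproved.) [ReedSimonIV1978, Kato1966, LSSY2005,
BaryshnikovBubenikKahle2013, Kahle2012,
Literature.MathematicalPhysics.QuantumManyBody.BoseGas.HasUniqueGroundState]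
#5 GroundStateRigidity (crux) — (stmt-AtomisticToContinuum-9072 verbatim, shared with
BECCutLineWeakDisorder / BECClassicalWindow) for every repulsive finite-range v there is ρ₀ > 0 such
that for 0 < ρ < ρ₀ and all large N, for every η > 0 there is δ > 0 with: any two δ-near-minimisers
Ψ, Φ of the Dirichlet energy in the box of side (N/ρ)^(1/3) satisfy ∫|Ψ − cΦ|² ≤ η for some unit
complex c (compact resolvent, spectral gap at fixed N). It is the near-minimiser compactness that
carries the flat-mode occupation of Ψ₀ to all δ-near-minimisers (NearMinimiserTransfer).
[difficulty: M] (why it might fail: ⊤-valued v: {V<∞} may disconnect and H decouples; unless the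
fluid component is the unique minimiser mod symmetry at every large N the cube's symmetries force
degeneracy and no δ pins the phase (BBK2013, DLM2010) — open for hard cores.) [ReedSimonIV1978,
Simon1982, BaryshnikovBubenikKahle2013, Kahle2012, DiaconisLebeauMichel2010, LSSY2005]
#9 WallLayerMass (support) — for every repulsive finite-range v and all b > 0, β > 0, at all small ρ
(depending on v, b, β) and all large N, the canonical Dirichlet ground state Ψ₀ = groundState v
(N+1) L gives mass ≤ β to {particle 0 within b of a face}: ∫ 1{∃k: X₀ₖ ≤ b ∨ L−b ≤ X₀ₖ} Ψ₀(X)² dX ≤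
β (junk branch Ψ₀ = 0 trivial). Proof sketch: 1-D Hardy ∫₀ᵇu² ≤ 4b²∫u'² per face and coordinate ⇒
P(layer) ≤ 8b²·(kinetic energy per particle) for the approximating C¹ trial states (Bose symmetry);
E₀(N+1, L) ≤ C(N+1)ρ^(2/3) by the symmetrised product of disjoint one-body bumps on a lattice of
spacing ρ^(−1/3)/2 > 2·range (no interaction); pass to the L²-limit (IsGroundState.exists_tendstoL2
+ closedEnergy). [difficulty: M] [LSSY2005, ReedSimonIV1978]
#9 GroundStateFlatMode (support) — MILESTONE (conjecture-strength on its own — it is Dirichlet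
ground-state BEC in the flat mode; in this route it is proved ONLY as the conclusion of
LandscapeTransfer, do not attack it directly): for every repulsive finite-range v, at all small ρ,
some c > 0: for all large N, if the Dirichlet ground state is unique then the flat mode φ₀ =
L^(−3/2)·1_box has occupation ≥ c(N+1) in groundState v (N+1) L. [difficulty: open-problem]
[LSSY2005, PenroseOnsager1956]
#9 LandscapeTransfer (support) — GLUE (pure measure theory, paper-checked in the a.e. setting):
WallDressing → TorusLandscapeDirichletTypical → WallLayerMass → GroundStatePair →
GroundStateFlatMode. Fix v; a := max(a₀ᵂ, a₀ᵀ); ρ₀ := min of the four; for ρ < ρ₀: c₀ := c(ε=0,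
η=1/8, a) from T, ε₁ := min(c₀,1)/24, C := C(ε₁, 1/8) from W, c₁ := c(ε₁, 1/8, a) from T, layer
budget β = 1/8 with b := a from WallLayerMass, Φ₀ and uniqueness from GroundStatePair; eventually
also a < ε₁L and L > 6a/c₀. For good Y (outside the three bad sets; non-strict T gives Q = ∫_Λ'Φ₀² >
0, Q₀ = ∫_box Φ₀² > 0): s ≡ 1 on Λ' ⊆ Λ_a (ℓ ≤ ε₁L); integrating the a.e. pair inequality ×Ψ₀(x)
over Λ'² and Cauchy–Schwarz give B·P² ≤ C²A²Q, whence with T(ε₁): A² ≥ (c₁/C²)|Λ'|·B (A, B = ∫_Λ'Ψ₀,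
∫_Λ'Ψ₀²; P, Q for Φ₀); integrating it over Λ_a × Λ' gives D·Q ≤ C²·Q₀·B (D = ∫_Λa Ψ₀²) and T(0)
gives Q ≥ c₀Q₀/4 (6ε₁ ≤ c₀/4), so (∫_box Ψ₀)² ≥ A² ≥ (c₀c₁/32C⁴)·L³·D (|Λ'| ≥ L³/8). Fubini over X =
x :: Y (measurePreserving piFinSuccAbove), ∫Ψ₀² = 1 (lintegral_groundState_sq), layer ≤ 1/8 and bad
masses ≤ 3/8: occupation ≥ (N+1)·c₀c₁/(64C⁴). [difficulty: M] [LSSY2005, PenroseOnsager1956]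
#9 NearMinimiserTransfer (support) — GLUE: GroundStateFlatMode (INLINED verbatim as the first
hypothesis since rev 2, because support items render in item-id order and this item's id precedes
GroundStateFlatMode's) → GroundStateRigidity → GroundStatePair → ZeroModeOccupation. Index shift N =
M+1 under ∀ᶠ; Ψ₀ = groundState is a ground state (HasUniqueGroundState.isGroundState_groundState),
so by the definition of closedEnergy as an infimum over L²-approximating trial sequences there are
trial states Φ with energy ≤ E₀ + δ arbitrarily L²-close to Ψ₀ (E₀ < ⊤ by
IsGroundState.groundStateEnergy_ne_top); with η = c/16 and δ from GroundStateRigidity every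
δ-near-minimiser Ψ is within 2√η of a phase times Ψ₀ in L²; √occupation is √(M+1)-Lipschitz in L²
(Cauchy–Schwarz in x with ‖φ₀‖₂ = 1, Minkowski in L²(dY), Fubini) and phase-blind, so occupation(Ψ)
≥ (√c − 2√η)²(M+1) ≥ c(M+1)/4. [difficulty: M] [LSSY2005, Kato1966]

TWO-LAYER PLAN. Foreseen glued splits (none filed now; k ≤ 3, depth 1): WallDressing ⇐
InteriorRatioHarnack (essential oscillation of Ψ₀/Φ₀ over the inner cube only, s-free)
→ LayerComparison (Carleson/Hopf comparability Ψ₀ ≍ s·Φ₀·r on a < dist < εL, two healing lengths as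
sub/super-solutions) → WallDressing.
TorusLandscapeDirichletTypical ⇐ TorusLandscapeTypical (same event, failure mass ≤ η under the TORUS
law π_P of the side-(L+a) ground state: the deliverable of the
torus engines, by Markov from an averaged participation bound plus concentration) →
WallConditioningStability (π_P-typical ⇒ w_D-typical for this bulk event; the
relative entropy H(w_D|π_P) is the surface-order O(N^(2/3)·ξρ^(1/3)) quantity, so exponential
concentration at speed N^(2/3) suffices) → TLDT; alternative child: a
sup-form over a coarse-density class of environments + a large-deviation bound for that class under
w_D. GroundStatePair ⇐ Dirichlet half (HasUniqueGroundState,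
finite v first) → torus half → pair.

KILL CRITERIA. A proof that the essential one-particle oscillation of Ψ₀/(Φ₀·s) grows with N for
some admissible v at arbitrarily small ρ (a log L from an unscreened a/r tail,
or an explicit 1-D / Bethe-ansatz or N = 2,3 witness showing L-dependence beyond the profile)
refutes WallDressing: close `refuted:WallDressing` (the line is dead;
hand the witness to card bc-transfer-influence-factorisation). ¬TorusLandscapeDirichletTypical by a
torus-side witness (landscape ratio not concentrated under the
Dirichlet law) forces the pivot to the sup-form / coarse-density split or to consuming a Palm-tilt
transfer; ¬GroundStatePair or ¬GroundStateRigidity for pathological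
⊤-valued v forces a restatement over finite v plus a separate item for hard cores (repair, not
death). A refutation of X_B1 (stmt-0686) kills this route together
with BECInfraredBound/BECStoquasticCensoring. BoundaryTransferWeak (stmt-0827) proved by other means
moots the route's purpose (WallDressing stays of independent interest).

NOT DECOMPOSED YET. The constants C(ε,η,a), c(ε,η,a) and the choice ℓ ≍ healing length
(8πρa)^(−1/2); measurability of the bad sets (volume of a jointly measurable family of pair
sets) and the Fubini / MeasurableEquiv.piFinSuccAbove plumbing (inside LandscapeTransfer); the Hardy
inequality and the lattice trial state (inside WallLayerMass);
the closedEnergy-approximation lemma and the L²-Lipschitz bound for √occupation of non-C¹ states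
(inside NearMinimiserTransfer); hard-core connectivity and
elliptic regularity (inside GroundStatePair); the coarse-density class and its large-deviation bound
(layer-2 child of the torus crux); behaviour within a of the
faces, edges and corners (deliberately NOT claimed: paid by WallLayerMass).

CHEAPEST FALSIFIER. Free gas v ≡ 0 (admissible!) — done by hand and recorded in the crux texts: Ψ₀ =
∏ sin(πx_k/L)·(2/L)^(3(N+1)/2), Φ₀ = const on the torus of side L+a; with ℓ =
min(ε,1/2)·L the per-coordinate ratio sin(πt/L)/min(1,t/ℓ,(L−t)/ℓ) lies in [sin(πℓ/L), π/2], so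
WallDressing holds with C = (π/(2sin(πℓ/L)))³ and EMPTY bad set;
T holds with c = 1/2 (ratio ≡ 1), GroundStatePair/Rigidity by the gaps π²/L², (2π/(L+a))²,
WallLayerMass by 4π²b³/L³ → 0, and X_B1 with c → (8/π²)³ ≈ 0.533.
Next cheapest (not run here; kit not in this seat's payload): the 1-D Lieb–Liniger gas in a
hard-wall box (Gaudin 1971 doi:10.1103/PhysRevA.4.386; Batchelor–Guan–
Oelkers–Lee 2005 doi:10.1088/0305-4470/38/36/001), where Ψ_D and Ψ_P are explicit Bethe states:
compute the oscillation of log Ψ_D/(Ψ_P·s) in the tagged variable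
as N grows (WallDressing is dimension-blind; T is not and is false there); then N = 2,3 grid
numerics of Ψ_D/Ψ_P in 3-D with a hard core, torus side L+a vs L
(the latter must show the image-pair degeneracy this route removed).

NUMBERS. Healing length ξ = (8πρa)^(−1/2) (GP); free-gas flat-mode fraction in the Dirichlet box
(8/π²)³ ≈ 0.533 (refuter notes on stmt-0733); free-gas WallDressing
constant C = (π/(2 sin(πε)))³ for ε ≤ 1/2; LandscapeTransfer output c = c₀c₁/(64C⁴) with budgets η =
1/8 (three bad sets) and layer mass β = 1/8, ε₁ = min(c₀,1)/24;
WallLayerMass needs 8b²·12π²ρ^(2/3)·(1+o(1)) ≤ β; expected number of opposite-face image pairs at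
torus side L (the removed degeneracy) ≍ ρ²L²R₀⁸/ξ⁴ → ∞.
Items at open: 10 (1 target, 4 cruxes, 4 support, 1 assembly); shared by signature:
ZeroModeOccupation = stmt-0686, GroundStateRigidity = stmt-9072. Repair log 2026-08-15 (route-repair
planner): the route's wanted_by link on the shared stmt-9072 was missing after open (registry lint
glue.extra-hypothesis 19:24Z); re-attached (rev 1), and the two glue items re-filed —
NearMinimiserTransfer = stmt-13728 (GroundStateFlatMode inlined), Assembly = stmt-13738 (hypothesis
order WallDressing, TorusLandscapeDirichletTypical, GroundStatePair, WallLayerMass,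
GroundStateRigidity, LandscapeTransfer, NearMinimiserTransfer) — meaning unchanged; rev 2 READY
(glue OK, staffable, cruxes vetted 4/4).

DEFINITION REQUESTS. None filed. The Dirichlet side uses the landed
`Literature.MathematicalPhysics.QuantumManyBody.BoseGas.groundState` / `HasUniqueGroundState` /
`IsGroundState`
(GroundState.lean, fact-free). A torus twin (`periodicGroundState`, `IsPeriodicGroundState`,
`HasUniquePeriodicGroundState` in
Literature/MathematicalPhysics/QuantumManyBody) would replace the inlined torus interface in W/T/G
by one name; to be requested by a tenure pass if a second route
adopts the interface, not now (it would delay typing of the cruxes).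

Novelty: Searches (2026-08-15, this seat): `lit search --hybrid "Dirichlet boundary conditions Bose-Einstein
condensation interacting Bose gas ground state boundary layer
healing length"` (12 hits, textbooks only); `lit galaxy search --star all` ×4 ("Bose gas hard wall
boundary layer condensate wave function healing length", "Bose gas
near a hard wall", "surface tension of a dilute Bose gas", "Dirichlet and periodic ground states": 0
rows each); `lit galaxy search --star pdf --mode bm25 "<condensate
fraction Dirichlet vs periodic, hard wall, healing length, ratio of ground states>"` (10:
arXiv:2503.21908 Henkel "Quantum Borderlines" = Bogoliubov-level border
fluctuation energies; doi:10.1103/PhysRevA.91.013626 wetting of BEC mixtures at walls, GP level;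
rest off-topic); `lit search --source crossref "interacting Bose gas
hard wall surface energy boundary layer Gross-Pitaevskii half space"` (12: doi:10.1063/5.0089790
Basti2022 energy to second order, doi:10.1007/s002200100533 LSY 2-D GP,
doi:10.1063/5.0310157 Caraci 2026 Wu term — energies only); `lit search --source arxiv|zbmath` (0),
OpenAlex HTTP 429; plus the card's, audit-5/15/29/32's and the
gen-1 route's recorded searches (hybrid/vsearch on boundary Harnack × Bose gas: LSSY2005 pp.
8,15,36,55 only; zbMATH "boundary Harnack infinite dimensional" →
Wang2012; crossref → Margetis2000; lit frontier AtomisticToContinuum --since 2022 →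
arXiv:2603.20776, arXiv:2510.20493, arXiv:2602.16566).
Nearest prior art found: LiebSeiringer2002 / L  [refs: 10.1103/PhysRevA.91.013626, 10.1063/5.0089790, 10.1007/s002200100533, 10.1063/5.0310157, 2503.21908, 2603.20776, 2510.20493, 2602.16566, doi:10.1103/PhysRevA.91.013626, doi:10.1063/5.0089790, doi:10.1007/s002200100533, doi:10.1063/5.0310157, Basti2022, LSSY2005, Wang2012, Margetis2000, LiebSeiringer2002, Junge2026, DaviesSimon1984, BassBurdzy1991, Pinsky1995, Robinson1976]

Barriers (technique_class: boundary-layer-factorisation principal-eigenfunction-ratio): - technique_class: boundary-layer-factorisation principal-eigenfunction-ratio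
- Literature.Barriers.AtomisticToContinuum.KineticGapLengthScales: evaded — no kinetic gap and no
energy localisation anywhere; the comparison is multiplicative and (essentially) pointwise in one
variable, energies enter only through the crude a-priori bound E₀ ≤ C·N·ρ^(2/3) in WallLayerMass and
the fixed-N gap inside GroundStateRigidity (δ after N); honest residue: if the Harnack constant of
WallDressing secretly pays the L² Poincaré constant of the ground-state diffusion the crux fails —
that is its why-might-fail, not a use of the blocked technique.
- Literature.Barriers.AtomisticToContinuum.EnergyAsymptoticsWithoutCondensation: evaded — nothing is
inferred from energy asymptotics (the 1-D Lieb–Liniger witness is respected: the torus crux is false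
in d = 1 and the route creates no condensation, it transports it).
- Literature.Barriers.AtomisticToContinuum.BogoliubovPerturbationInfrared: not engaged — no
expansion around a Bogoliubov state; used only as a guide (the wall is a density-channel,
gauge-invariant perturbation, the IR-benign class).
- Literature.Barriers.AtomisticToContinuum.CasimirBoxGeneralizedCondensation: confined to isotropic
cubes L = (N/ρ)^(1/3); the conclusion is macroscopic occupation of ONE explicit mode (type I), and
the transfer is a structural lemma rather than an assumption — exactly what the Casimir-box
phenomenon (PuleZagrebnov2004) demands; a Casimir-box version is not

History (route lifecycle, newest last):
- 2026-08-15T20:20:48Z · rev 2: restated NearMinimiserTransfer (stmt-AtomisticToContinuum-13831), Assembly (stmt-AtomisticToContinuum-13832) — repair glue.extra-hypothesis, step 2/2: restate the two glue items TODO-blocked by the stale missing-decl flag (GroundStateRigidity is listed again after step 1 (planner-rrepair-AtomisticToContinuum-BECWallDr-1cc5991c-0)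
- 2026-08-15T20:25:44Z · rev 2: restated NearMinimiserTransfer (stmt-AtomisticToContinuum-13737) — repair glue.extra-hypothesis, step 3: the restated glue item NearMinimiserTransfer (stmt-13737) renders BEFORE GroundStateFlatMode (stmt-13829) because support (planner-rrepair-AtomisticToContinuum-BECWallDr-1cc5991c-0)
- 2026-08-25T09:13:53Z · DORMANT — reconciler: no traction for 7.6 d (last activity item-evidence-added at 2026-08-17T19:09:23Z); parked, not closed — `ledger route dormant route-AtomisticToConti (operator:999:4098009)

sub-problem: BoseEinsteinCondensation · status: dormant · opened planner-plancard-AtomisticToContinuum-BoseEin-f0f8cf77-g2-0 2026-08-15T19:03:33Z · rev 3 · ledger route-AtomisticToContinuum-BECWallDressingTransfer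
GENERATED by the gate from the ledger (D-0016/17). Provers cite these decls: `theorem foo : Summit.AtomisticToContinuum.BoseEinsteinCondensation.Theses.BECWallDressingTransfer.<Decl> := …` in Summits/AtomisticToContinuum/BoseEinsteinCondensation/Theorems/<Name>.lean.
-/

namespace Summit.AtomisticToContinuum.BoseEinsteinCondensation.Theses.BECWallDressingTransfer

open scoped BigOperators Topology Manifold Classical MeasureTheory ProbabilityTheory Matrix InnerProductSpace ComplexConjugate ContinuousMap
open Filter Set Function TopologicalSpace MeasureTheory

attribute [summit_statement] _root_.BoseEinsteinCondensation

/-- item stmt-AtomisticToContinuum-0686 · target · rank 0 · open · by planner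
why it might fail: it is flat-mode Dirichlet BEC itself (implies the conjunct); fails only with the conjunct, or if the flat mode is the wrong mode (it is not: free gas (8/π²)³, interacting gas heals beyond ξ ≪ L).
sources: LSSY2005, PenroseOnsager1956, Robinson1976
X_B1: zero-mode macroscopic occupation. For every repulsive finite-range v, at all small densities
ρ, for all large N there is δ > 0 such that every δ-near-minimiser Ψ of the Dirichlet N-body energy
in the box of side (N/ρ)^{1/3} has ⟨φ₀, γ_Ψ φ₀⟩ ≥ cN for the normalised constant mode φ₀ =
L^{-3/2}·1_box (c > 0 depending on v, ρ). -/
@[route_item "route-AtomisticToContinuum-BECWallDressingTransfer"]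
def ZeroModeOccupation : Prop :=
  ∀ v : ℝ → ENNReal, Literature.MathematicalPhysics.QuantumManyBody.BoseGas.IsRepulsiveFiniteRange v → ∃ ρ₀ : ℝ, 0 < ρ₀ ∧ ∀ ρ : ℝ, 0 < ρ → ρ < ρ₀ → ∃ c : ℝ, 0 < c ∧ ∀ᶠ N : ℕ in Filter.atTop, ∃ δ : ENNReal, 0 < δ ∧ ∀ Ψ : Literature.MathematicalPhysics.QuantumManyBody.BoseGas.TrialState N (Literature.MathematicalPhysics.QuantumManyBody.BoseGas.sideLength ρ N), Literature.MathematicalPhysics.QuantumManyBody.BoseGas.energy v Ψ ≤ Literature.MathematicalPhysics.QuantumManyBody.BoseGas.groundStateEnergy v N (Literature.MathematicalPhysics.QuantumManyBody.BoseGas.sideLength ρ N) + δ → ENNReal.ofReal (c * N) ≤ Literature.MathematicalPhysics.QuantumManyBody.BoseGas.occupation N ((Literature.MathematicalPhysics.QuantumManyBody.BoseGas.box (Literature.MathematicalPhysics.QuantumManyBody.BoseGas.sideLength ρ N)).indicator fun _ => ((Real.sqrt (Literature.MathematicalPhysics.QuantumManyBody.BoseGas.sideLength ρ N ^ 3))⁻¹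 : ℂ)) Ψ.ψ

/-- item stmt-AtomisticToContinuum-13825 · crux · rank 2 · open · by planner
why it might fail: Ψ_D/Ψ_P is harmonic for the FULL 3(N+1)-dim ground-state diffusion, not in x alone: Harnack/IU constants grow with dimension (DaviesSimon1984) unless the drift ∇log Φ₀² is controlled uniformly (Wang2012); an L²-Poincaré loss or an unscreened phonon tail gives osc ~ log L.
sources: DaviesSimon1984, BassBurdzy1991, Pinsky1995, Wang2012, LiebSeiringer2002, LSSY2005
[crux] (card W1, a.e.-robust boundary-Harnack form) for every repulsive finite-range v there is a₀ >
0 (> its range) such that for every a ≥ a₀, at all small ρ, for every ε > 0 and η > 0 there is C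
with: for all large N, if the Dirichlet ground state Ψ₀ = groundState v (N+1) L (L = sideLength ρ
(N+1)) is unique, there is ℓ ∈ (0, εL] such that for every torus ground state Φ₀ of side L+a
(inlined interface) the set of environments Y ∈ (ℝ³)^N whose violating pairs {(x,y) ∈ Λ_a² :
C·Ψ₀(y::Y)Φ₀(x::Y)s(x) < Ψ₀(x::Y)Φ₀(y::Y)s(y)} have positive volume — i.e. the essential
one-particle oscillation of Ψ₀/(Φ₀·s) over Λ_a = (a, L−a)³ exceeds C; s(z) = ∏_k min(1, z_k/ℓ,
(L−z_k)/ℓ) — has w_D-mass ≤ η. Free gas: ℓ = min(ε,1/2)L, C = (π/(2 sin(πℓ/L)))³, bad set empty.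
[difficulty: XL] -/
@[route_item "route-AtomisticToContinuum-BECWallDressingTransfer", crux]
def WallDressing : Prop :=
  ∀ v : ℝ → ENNReal, Literature.MathematicalPhysics.QuantumManyBody.BoseGas.IsRepulsiveFiniteRange v → ∃ a₀ : ℝ, 0 < a₀ ∧ ∀ a : ℝ, a₀ ≤ a → ∃ ρ₀ : ℝ, 0 < ρ₀ ∧ ∀ ρ : ℝ, 0 < ρ → ρ < ρ₀ → ∀ ε : ℝ, 0 < ε → ∀ η : ℝ, 0 < η → ∃ C : ℝ, 0 < C ∧ ∀ᶠ N : ℕ in Filter.atTop, let L : ℝ := Literature.MathematicalPhysics.QuantumManyBody.BoseGas.sideLength ρ (N + 1); let Ψ₀ : Literature.MathematicalPhysics.QuantumManyBody.BoseGas.Config (N + 1) → ℝ := Literature.MathematicalPhysics.QuantumManyBody.BoseGas.groundState v (N + 1) L; Literature.MathematicalPhysics.QuantumManyBody.BoseGas.HasUniqueGroundState v (N + 1) L → ∃ ℓ : ℝ, 0 < ℓ ∧ ℓ ≤ ε * L ∧ (let Λa : Set Literature.MathematicalPhysics.QuantumManyBody.BoseGas.Space := {z : Literature.MathematicalPhysics.QuantumManyBody.BoseGas.Space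 | ∀ k, z k ∈ Set.Ioo a (L - a)}; let s : Literature.MathematicalPhysics.QuantumManyBody.BoseGas.Space → ℝ := fun z => ∏ k : Fin 3, min 1 (min (z k / ℓ) ((L - z k) / ℓ)); ∀ Φ₀ : Literature.MathematicalPhysics.QuantumManyBody.BoseGas.Config (N + 1) → ℝ, (Continuous Φ₀ ∧ (∀ (X : Literature.MathematicalPhysics.QuantumManyBody.BoseGas.Config (N + 1)) (i : Fin (N + 1)) (k : Fin 3), Φ₀ (X + Pi.single i (EuclideanSpace.single k (L + a))) = Φ₀ X) ∧ (∀ X, 0 ≤ Φ₀ X) ∧ ∀ η' : ℝ, 0 < η' → ∃ δ : ENNReal, 0 < δ ∧ ∀ Φ : Literature.MathematicalPhysics.QuantumManyBody.BoseGas.PeriodicTrialState (N + 1) (L + a), Literature.MathematicalPhysics.QuantumManyBody.BoseGas.periodicEnergy v Φ ≤ Literature.MathematicalPhysics.QuantumManyBody.BoseGas.periodicGroundStateEnergy v (N + 1) (L + a) + δ → ∃ θ : ℝ, ∫⁻ X in Literature.MathematicalPhysics.QuantumManyBody.BoseGas.cellN (N + 1) (L + a), (‖Φ.ψ X - Complex.exp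 (↑θ * Complex.I) * (Φ₀ X : ℂ)‖₊ : ENNReal) ^ 2 ≤ ENNReal.ofReal η') → ∫⁻ Y : Literature.MathematicalPhysics.QuantumManyBody.BoseGas.Config N, Set.indicator {Y : Literature.MathematicalPhysics.QuantumManyBody.BoseGas.Config N | MeasureTheory.volume {p : Literature.MathematicalPhysics.QuantumManyBody.BoseGas.Space × Literature.MathematicalPhysics.QuantumManyBody.BoseGas.Space | p.1 ∈ Λa ∧ p.2 ∈ Λa ∧ C * (Ψ₀ (Matrix.vecCons p.2 Y) * Φ₀ (Matrix.vecCons p.1 Y) * s p.1) < Ψ₀ (Matrix.vecCons p.1 Y) * Φ₀ (Matrix.vecCons p.2 Y) * s p.2} ≠ 0} (fun _ => (1 : ENNReal)) Y * (∫⁻ x : Literature.MathematicalPhysics.QuantumManyBody.BoseGas.Space, ENNReal.ofReal (Ψ₀ (Matrix.vecCons x Y) ^ 2)) ≤ ENNReal.ofReal η)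

/-- item stmt-AtomisticToContinuum-13826 · crux · rank 3 · open · by planner
why it might fail: Dirichlet-typical Y (depleted wall layer, ~N^(2/3) displaced bosons) are torus-atypical at large-deviation scale; torus engines give π_P-AVERAGES of the landscape ratio only (E R ≥ c, not R ≥ c(η) off mass η); needs concentration + stability under wall conditioning. False in d = 1.
sources: LSSY2005, Fournais2020, Junge2026, ChongLiangNam2026, arXiv:2603.20776, arXiv:2510.20493
[crux] (card W2 + the torus input, jointly, typical-set form) for every repulsive finite-range v
there is a₀ ≥ 0 such that for every a ≥ a₀, at all small ρ, for every ε ∈ [0,1/4) and η > 0 there is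
c > 0 with: for all large N, if the Dirichlet ground state is unique, for every torus ground state
Φ₀ of N+1 bosons on the torus of side L+a (interface) the set of environments Y for which (∫_Λ'ε
Φ₀(x::Y)dx)² ≤ c·|Λ'ε|·∫_Λ'ε Φ₀(x::Y)²dx on the inner cube Λ'_ε = (εL, L−εL)³ of the BOX
(non-strict: identically vanishing slices count as bad) has w_D-mass ≤ η — delocalisation of the
torus landscape, measured under the DIRICHLET law of the environment. Free gas: Φ₀ constant, c =
1/2, bad set empty. [difficulty: XL] -/
@[route_item "route-AtomisticToContinuum-BECWallDressingTransfer", crux]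
def TorusLandscapeDirichletTypical : Prop :=
  ∀ v : ℝ → ENNReal, Literature.MathematicalPhysics.QuantumManyBody.BoseGas.IsRepulsiveFiniteRange v → ∃ a₀ : ℝ, 0 ≤ a₀ ∧ ∀ a : ℝ, a₀ ≤ a → ∃ ρ₀ : ℝ, 0 < ρ₀ ∧ ∀ ρ : ℝ, 0 < ρ → ρ < ρ₀ → ∀ ε : ℝ, 0 ≤ ε → ε < 1 / 4 → ∀ η : ℝ, 0 < η → ∃ c : ℝ, 0 < c ∧ ∀ᶠ N : ℕ in Filter.atTop, let L : ℝ := Literature.MathematicalPhysics.QuantumManyBody.BoseGas.sideLength ρ (N + 1); let Ψ₀ : Literature.MathematicalPhysics.QuantumManyBody.BoseGas.Config (N + 1) → ℝ := Literature.MathematicalPhysics.QuantumManyBody.BoseGas.groundState v (N + 1) L; let Λ' : Set Literature.MathematicalPhysics.QuantumManyBody.BoseGas.Space := {z : Literature.MathematicalPhysics.QuantumManyBody.BoseGas.Space | ∀ j, z j ∈ Set.Ioo (ε * L) (L - ε * L)}; Literature.MathematicalPhysics.QuantumManyBody.BoseGas.HasUniqueGroundState v (N + 1) L → ∀ Φ₀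 : Literature.MathematicalPhysics.QuantumManyBody.BoseGas.Config (N + 1) → ℝ, (Continuous Φ₀ ∧ (∀ (X : Literature.MathematicalPhysics.QuantumManyBody.BoseGas.Config (N + 1)) (i : Fin (N + 1)) (k : Fin 3), Φ₀ (X + Pi.single i (EuclideanSpace.single k (L + a))) = Φ₀ X) ∧ (∀ X, 0 ≤ Φ₀ X) ∧ ∀ η' : ℝ, 0 < η' → ∃ δ : ENNReal, 0 < δ ∧ ∀ Φ : Literature.MathematicalPhysics.QuantumManyBody.BoseGas.PeriodicTrialState (N + 1) (L + a), Literature.MathematicalPhysics.QuantumManyBody.BoseGas.periodicEnergy v Φ ≤ Literature.MathematicalPhysics.QuantumManyBody.BoseGas.periodicGroundStateEnergy v (N + 1) (L + a) + δ → ∃ θ : ℝ, ∫⁻ X in Literature.MathematicalPhysics.QuantumManyBody.BoseGas.cellN (N + 1) (L + a), (‖Φ.ψ X - Complex.exp (↑θ * Complex.I) * (Φ₀ X : ℂ)‖₊ : ENNReal) ^ 2 ≤ ENNReal.ofReal η') → ∫⁻ Y : Literature.MathematicalPhysics.QuantumManyBody.BoseGas.Config N, Set.indicator {Y : Literature.MathematicalPhysics.QuantumManyBody.BoseGas.Config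 N | (∫⁻ x in Λ', ENNReal.ofReal (Φ₀ (Matrix.vecCons x Y))) ^ 2 ≤ ENNReal.ofReal c * MeasureTheory.volume Λ' * ∫⁻ x in Λ', ENNReal.ofReal (Φ₀ (Matrix.vecCons x Y) ^ 2)} (fun _ => (1 : ENNReal)) Y * (∫⁻ x : Literature.MathematicalPhysics.QuantumManyBody.BoseGas.Space, ENNReal.ofReal (Ψ₀ (Matrix.vecCons x Y) ^ 2)) ≤ ENNReal.ofReal η

/-- item stmt-AtomisticToContinuum-13827 · crux · rank 4 · open · by planner
why it might fail: ⊤-valued v (hard cores/shells) are admissible: the accessible region may disconnect and the cube's symmetries then force exact degeneracy unless the dilute component is the unique energy minimiser (unproved); continuity of the torus ground state for wild measurable v is unproved.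
sources: ReedSimonIV1978, Kato1966, LSSY2005, BaryshnikovBubenikKahle2013, Kahle2012, Literature.MathematicalPhysics.QuantumManyBody.BoseGas.HasUniqueGroundState
[crux] for every repulsive finite-range v and every a ≥ 0, at all small ρ and for all large N (L =
sideLength ρ (N+1)): `HasUniqueGroundState v (N+1) L` (a nonnegative Dirichlet ground state exists
and ground states are unique up to phase — so `groundState v (N+1) L` is it), AND the torus
interface of side L+a is inhabited: a continuous, (L+a)-periodic, nonnegative Φ₀ such that for every
η' > 0 some δ > 0 puts every periodic δ-near-minimiser within η' of e^(iθ)Φ₀ in L²(cell^(N+1))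
(existence + uniqueness up to phase + continuity of the torus ground state: compact resolvent,
positivity-improving semigroup, elliptic regularity; E₀ < ⊤ at ρ < c·range⁻³ by a lattice product
trial state). [difficulty: L] -/
@[route_item "route-AtomisticToContinuum-BECWallDressingTransfer", crux]
def GroundStatePair : Prop :=
  ∀ v : ℝ → ENNReal, Literature.MathematicalPhysics.QuantumManyBody.BoseGas.IsRepulsiveFiniteRange v → ∀ a : ℝ, 0 ≤ a → ∃ ρ₀ : ℝ, 0 < ρ₀ ∧ ∀ ρ : ℝ, 0 < ρ → ρ < ρ₀ → ∀ᶠ N : ℕ in Filter.atTop, let L : ℝ := Literature.MathematicalPhysics.QuantumManyBody.BoseGas.sideLength ρ (N + 1); Literature.MathematicalPhysics.QuantumManyBody.BoseGas.HasUniqueGroundState v (N + 1) L ∧ ∃ Φ₀ : Literature.MathematicalPhysics.QuantumManyBody.BoseGas.Config (N + 1) → ℝ, (Continuous Φ₀ ∧ (∀ (X : Literature.MathematicalPhysics.QuantumManyBody.BoseGas.Config (N + 1)) (i : Fin (N + 1)) (k : Fin 3), Φ₀ (X + Pi.single i (EuclideanSpace.single k (L + a))) = Φ₀ X) ∧ (∀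 X, 0 ≤ Φ₀ X) ∧ ∀ η' : ℝ, 0 < η' → ∃ δ : ENNReal, 0 < δ ∧ ∀ Φ : Literature.MathematicalPhysics.QuantumManyBody.BoseGas.PeriodicTrialState (N + 1) (L + a), Literature.MathematicalPhysics.QuantumManyBody.BoseGas.periodicEnergy v Φ ≤ Literature.MathematicalPhysics.QuantumManyBody.BoseGas.periodicGroundStateEnergy v (N + 1) (L + a) + δ → ∃ θ : ℝ, ∫⁻ X in Literature.MathematicalPhysics.QuantumManyBody.BoseGas.cellN (N + 1) (L + a), (‖Φ.ψ X - Complex.exp (↑θ * Complex.I) * (Φ₀ X : ℂ)‖₊ : ENNReal) ^ 2 ≤ ENNReal.ofReal η')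

/-- item stmt-AtomisticToContinuum-9072 · crux · rank 5 · open · by planner
why it might fail: ⊤-valued v: {V<∞} may disconnect and H decouples; unless the fluid component is the unique minimiser mod symmetry at every large N the cube's symmetries force degeneracy and no δ pins the phase (BBK2013, DLM2010) — open for hard cores.
sources: ReedSimonIV1978, Simon1982, BaryshnikovBubenikKahle2013, Kahle2012, DiaconisLebeauMichel2010, LSSY2005
[crux] (shared verbatim with BECPalmLandscape stmt-AtomisticToContinuum-3298; the uniqueness input
of the descent) for every repulsive finite-range v there is ρ₀ > 0 such that for 0 < ρ < ρ₀ and all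
large N, for every η > 0 there is δ > 0 with: any two δ-near-minimisers Ψ, Φ of the Dirichlet energy
in the box of side (N/ρ)^{1/3} satisfy ∫|Ψ − cΦ|² ≤ η for some unit complex c (E₀ < ∞, compact
resolvent, unique positive ground state and spectral gap at fixed N). [difficulty: M] -/
@[route_item "route-AtomisticToContinuum-BECWallDressingTransfer", crux]
def GroundStateRigidity : Prop :=
  ∀ v : ℝ → ENNReal, Literature.MathematicalPhysics.QuantumManyBody.BoseGas.IsRepulsiveFiniteRange v → ∃ ρ₀ : ℝ, 0 < ρ₀ ∧ ∀ ρ : ℝ, 0 < ρ → ρ < ρ₀ → ∀ᶠ N : ℕ in Filter.atTop, ∀ η : ℝ, 0 < η → ∃ δ : ENNReal, 0 < δ ∧ ∀ Ψ Φ : Literature.MathematicalPhysics.QuantumManyBody.BoseGas.TrialState N (Literature.MathematicalPhysics.QuantumManyBody.BoseGas.sideLength ρ N), Literature.MathematicalPhysics.QuantumManyBody.BoseGas.energy v Ψ ≤ Literature.MathematicalPhysics.QuantumManyBody.BoseGas.groundStateEnergy v N (Literature.MathematicalPhysics.QuantumManyBody.BoseGas.sideLength ρ N) + δ → Literature.MathematicalPhysics.QuantumManyBody.BoseGas.energy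 v Φ ≤ Literature.MathematicalPhysics.QuantumManyBody.BoseGas.groundStateEnergy v N (Literature.MathematicalPhysics.QuantumManyBody.BoseGas.sideLength ρ N) + δ → ∃ c : ℂ, ‖c‖ = 1 ∧ ∫⁻ X, (‖Ψ.ψ X - c * Φ.ψ X‖₊ : ENNReal) ^ 2 ≤ ENNReal.ofReal η

-- earlier NearMinimiserTransfer (stmt-AtomisticToContinuum-13737, replaced 2026-08-15T20:25:44Z -> stmt-AtomisticToContinuum-13728): retired by None — GroundStateFlatMode → GroundStateRigidity → GroundStatePair → ZeroModeOccupation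
-- earlier NearMinimiserTransfer (stmt-AtomisticToContinuum-13831, replaced 2026-08-15T20:20:48Z -> stmt-AtomisticToContinuum-13737): retired by None — GroundStateFlatMode → GroundStatePair → GroundStateRigidity → ZeroModeOccupation
/-- item stmt-AtomisticToContinuum-13728 · support · rank 9 · open · by planner
sources: LSSY2005, Kato1966
[support] GLUE (restated: the milestone GroundStateFlatMode is INLINED verbatim as the first
hypothesis because support items render in item-id order and this item's id precedes
GroundStateFlatMode's; hypothesis order GroundStateRigidity, GroundStatePair): flat-mode occupation
≥ c(N+1) of the unique Dirichlet ground state (= GroundStateFlatMode) → GroundStateRigidity →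
GroundStatePair → ZeroModeOccupation. Index shift N = M+1 under ∀ᶠ; Ψ₀ = groundState is a ground
state (HasUniqueGroundState.isGroundState_groundState), so by the definition of closedEnergy as an
infimum over L²-approximating trial sequences there are trial states Φ with energy ≤ E₀ + δ
arbitrarily L²-close to Ψ₀ (E₀ < ⊤ by IsGroundState.groundStateEnergy_ne_top); with η = c/16 and δ
from GroundStateRigidity every δ-near-minimiser Ψ is within 2√η of a phase times Ψ₀ in L²;
√occupation is √(M+1)-Lipschitz in L² (Cauchy–Schwarz in x with ‖φ₀‖₂ = 1, Minkowski in L²(dY),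
Fubini) and phase-blind, so occupation(Ψ) ≥ (√c − 2√η)²(M+1) ≥ c(M+1)/4. In `closes` it is fed `hL
hW hT hM hG : GroundStateFlatMode` (defeq by unfolding). [difficulty: M] -/
@[route_item "route-AtomisticToContinuum-BECWallDressingTransfer", crux]
def NearMinimiserTransfer : Prop :=
  (∀ v : ℝ → ENNReal, Literature.MathematicalPhysics.QuantumManyBody.BoseGas.IsRepulsiveFiniteRange v → ∃ ρ₀ : ℝ, 0 < ρ₀ ∧ ∀ ρ : ℝ, 0 < ρ → ρ < ρ₀ → ∃ c : ℝ, 0 < c ∧ ∀ᶠ N : ℕ in Filter.atTop, let L : ℝ := Literature.MathematicalPhysics.QuantumManyBody.BoseGas.sideLength ρ (N + 1); Literature.MathematicalPhysics.QuantumManyBody.BoseGas.HasUniqueGroundState v (N + 1) L → ENNReal.ofReal (c * (N + 1)) ≤ Literature.MathematicalPhysics.QuantumManyBody.BoseGas.occupation (N + 1) ((Literature.MathematicalPhysics.QuantumManyBody.BoseGas.box L).indicator fun _ => ((Real.sqrt (L ^ 3))⁻¹ : ℂ)) (fun X => (Literature.MathematicalPhysics.QuantumManyBody.BoseGas.groundState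 v (N + 1) L X : ℂ))) → GroundStateRigidity → GroundStatePair → ZeroModeOccupation

/-- item stmt-AtomisticToContinuum-13828 · support · rank 9 · open · by planner
sources: LSSY2005, ReedSimonIV1978
[support] for every repulsive finite-range v and all b > 0, β > 0, at all small ρ (depending on v,
b, β) and all large N, the canonical Dirichlet ground state Ψ₀ = groundState v (N+1) L gives mass ≤
β to {particle 0 within b of a face}: ∫ 1{∃k: X₀ₖ ≤ b ∨ L−b ≤ X₀ₖ} Ψ₀(X)² dX ≤ β (junk branch Ψ₀ = 0
trivial). Proof sketch: 1-D Hardy ∫₀ᵇu² ≤ 4b²∫u'² per face and coordinate ⇒ P(layer) ≤ 8b²·(kinetic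
energy per particle) for the approximating C¹ trial states (Bose symmetry); E₀(N+1, L) ≤
C(N+1)ρ^(2/3) by the symmetrised product of disjoint one-body bumps on a lattice of spacing
ρ^(−1/3)/2 > 2·range (no interaction); pass to the L²-limit (IsGroundState.exists_tendstoL2 +
closedEnergy). [difficulty: M] -/
@[route_item "route-AtomisticToContinuum-BECWallDressingTransfer", crux]
def WallLayerMass : Prop :=
  ∀ v : ℝ → ENNReal, Literature.MathematicalPhysics.QuantumManyBody.BoseGas.IsRepulsiveFiniteRange v → ∀ b : ℝ, 0 < b → ∀ β : ℝ, 0 < β → ∃ ρ₀ : ℝ, 0 < ρ₀ ∧ ∀ ρ : ℝ, 0 < ρ → ρ < ρ₀ → ∀ᶠ N : ℕ in Filter.atTop, let L : ℝ := Literature.MathematicalPhysics.QuantumManyBody.BoseGas.sideLength ρ (N + 1); ∫⁻ X : Literature.MathematicalPhysics.QuantumManyBody.BoseGas.Config (N + 1), Set.indicator {X : Literature.MathematicalPhysics.QuantumManyBody.BoseGas.Config (N + 1) | ∃ k, X 0 k ≤ b ∨ L - b ≤ X 0 k} (fun _ => (1 : ENNReal)) X * ENNReal.ofReal (Literature.MathematicalPhysics.QuantumManyBody.BoseGas.groundState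 v (N + 1) L X ^ 2) ≤ ENNReal.ofReal β

/-- item stmt-AtomisticToContinuum-13829 · support · rank 9 · open · by planner
sources: LSSY2005, PenroseOnsager1956
[support] MILESTONE (conjecture-strength on its own — it is Dirichlet ground-state BEC in the flat
mode; in this route it is proved ONLY as the conclusion of LandscapeTransfer, do not attack it
directly): for every repulsive finite-range v, at all small ρ, some c > 0: for all large N, if the
Dirichlet ground state is unique then the flat mode φ₀ = L^(−3/2)·1_box has occupation ≥ c(N+1) in
groundState v (N+1) L. [difficulty: open-problem] -/
@[route_item "route-AtomisticToContinuum-BECWallDressingTransfer"]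
def GroundStateFlatMode : Prop :=
  ∀ v : ℝ → ENNReal, Literature.MathematicalPhysics.QuantumManyBody.BoseGas.IsRepulsiveFiniteRange v → ∃ ρ₀ : ℝ, 0 < ρ₀ ∧ ∀ ρ : ℝ, 0 < ρ → ρ < ρ₀ → ∃ c : ℝ, 0 < c ∧ ∀ᶠ N : ℕ in Filter.atTop, let L : ℝ := Literature.MathematicalPhysics.QuantumManyBody.BoseGas.sideLength ρ (N + 1); Literature.MathematicalPhysics.QuantumManyBody.BoseGas.HasUniqueGroundState v (N + 1) L → ENNReal.ofReal (c * (N + 1)) ≤ Literature.MathematicalPhysics.QuantumManyBody.BoseGas.occupation (N + 1) ((Literature.MathematicalPhysics.QuantumManyBody.BoseGas.box L).indicator fun _ => ((Real.sqrt (L ^ 3))⁻¹ : ℂ)) (fun X => (Literature.MathematicalPhysics.QuantumManyBody.BoseGas.groundState v (N + 1) L X : ℂ))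

/-- item stmt-AtomisticToContinuum-13830 · support · rank 9 · open · by planner
sources: LSSY2005, PenroseOnsager1956
[support] GLUE (pure measure theory, paper-checked in the a.e. setting): WallDressing →
TorusLandscapeDirichletTypical → WallLayerMass → GroundStatePair → GroundStateFlatMode. Fix v; a :=
max(a₀ᵂ, a₀ᵀ); ρ₀ := min of the four; for ρ < ρ₀: c₀ := c(ε=0, η=1/8, a) from T, ε₁ := min(c₀,1)/24,
C := C(ε₁, 1/8) from W, c₁ := c(ε₁, 1/8, a) from T, layer budget β = 1/8 with b := a from
WallLayerMass, Φ₀ and uniqueness from GroundStatePair; eventually also a < ε₁L and L > 6a/c₀. For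
good Y (outside the three bad sets; non-strict T gives Q = ∫_Λ'Φ₀² > 0, Q₀ = ∫_box Φ₀² > 0): s ≡ 1
on Λ' ⊆ Λ_a (ℓ ≤ ε₁L); integrating the a.e. pair inequality ×Ψ₀(x) over Λ'² and Cauchy–Schwarz give
B·P² ≤ C²A²Q, whence with T(ε₁): A² ≥ (c₁/C²)|Λ'|·B (A, B = ∫_Λ'Ψ₀, ∫_Λ'Ψ₀²; P, Q for Φ₀);
integrating it over Λ_a × Λ' gives D·Q ≤ C²·Q₀·B (D = ∫_Λa Ψ₀²) and T(0) gives Q ≥ c₀Q₀/4 (6ε₁ ≤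
c₀/4), so (∫_box Ψ₀)² ≥ A² ≥ (c₀c₁/32C⁴)·L³·D (|Λ'| ≥ L³/8). Fubini over X = x :: Y
(measurePreserving piFinSuccAbove), ∫Ψ₀² = 1 (lintegral_groundState_sq), layer ≤ 1/8 and bad masses
≤ 3/8: occupation ≥ (N+1)·c₀c₁/(64C⁴). [difficulty: M] -/
@[route_item "route-AtomisticToContinuum-BECWallDressingTransfer", crux]
def LandscapeTransfer : Prop :=
  WallDressing → TorusLandscapeDirichletTypical → WallLayerMass → GroundStatePair → GroundStateFlatMode

-- earlier Assembly (stmt-AtomisticToContinuum-13832, replaced 2026-08-15T20:20:48Z -> stmt-AtomisticToContinuum-13738): retired by None — WallDressing → TorusLandscapeDirichletTypical → GroundStatePair → GroundStateRigidity → WallLayerMass → LandscapeTransfer → NearMinimiserTransfer → _root_.BoseEinsteinCondensation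
/-- item stmt-AtomisticToContinuum-13738 · assembly · rank 1 · open · by planner
sources: LSSY2005, PenroseOnsager1956
[assembly] (restated 1:1, hypothesis order permuted only) WallDressing →
TorusLandscapeDirichletTypical → GroundStatePair → WallLayerMass → GroundStateRigidity →
LandscapeTransfer → NearMinimiserTransfer → BoseEinsteinCondensation (the sub-problem abbrev,
_root_; = the type of `closes` up to hypothesis order). -/
@[route_item "route-AtomisticToContinuum-BECWallDressingTransfer"]
def Assembly : Prop :=
  WallDressing → TorusLandscapeDirichletTypical → GroundStatePair → WallLayerMass → GroundStateRigidity → LandscapeTransfer → NearMinimiserTransfer → _root_.BoseEinsteinCondensation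

/-! D-0027 §2.1 — DECIDING THEOREM (planner-authored via `route open/edit --closes-file`; by planner-rrepair-AtomisticToContinuum-BECWallDr-1cc5991c-0 2026-08-15T20:25:44Z):
its hypotheses are this route's items and its conclusion the sub-problem Statement (glue_lint), and it elaborates with this file. -/

@[closes "route-AtomisticToContinuum-BECWallDressingTransfer"] theorem closes (hW : WallDressing) (hT : TorusLandscapeDirichletTypical) (hG : GroundStatePair)
    (hR : GroundStateRigidity) (hM : WallLayerMass) (hL : LandscapeTransfer)
    (hN : NearMinimiserTransfer) : _root_.BoseEinsteinCondensation :=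
  AtomisticToContinuum.BECInfraredBound.bec_of_zeroMode (hN (hL hW hT hM hG) hR hG)

end Summit.AtomisticToContinuum.BoseEinsteinCondensation.Theses.BECWallDressingTransfer
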